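import Summits.QuantumFields.BalabanUV.Beta.D1BFx.PackedKernelSplit

/-!
# `BalabanUV.Beta.FP.WordPointwiseShape` — road «FP» for binder row D1, ROW KER-γ (α2) (owner memo `KER-GAMMA-ALPHA2.md` §3∕§5, R-FP-34∕35∕36):
# THE POINTWISE MIX SHAPE OF A WORD — the (hk) letter of `FineSplitJunctionTwoLeg.coarse_secondMoment_abs_twoLeg` ∕ `rem_of_twoLeg` for the two word
# shapes every near piece of the junction is made of (a tadpole word `tr (A ∘ W)`, a two-leg bubble word `tr (A ∘ V ∘ B ∘ W)` = `PackedKernelSplit.biBubble`),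
# from DISPLAYED per-leg letters `|A x y a b| ≤ C_A·e^{−r|x−y|₁}` and DISPLAYED r-WEIGHTED ℓ¹ JET MASSES at the anchors — generic fibre `F`, generic `D`,
# the leg rate `r` DECOUPLED from the jets' localisation

HONEST DEPENDENCY (page 1, mandatory): continuum YM on T⁴ ⇐ BetaPertH ∧ nine spine estimates (0/9 proved); BetaPertH ⇐ (D1) ∧ (D4) ∧
CAP+tail; G-an2-4 gates asym, D1 and NE2/3/4.  HONEST FRAMING (cell contract, verbatim): «discharging `BetaPertH` makes Bałaban's UV
stability UNCONDITIONAL — a real constructive-QFT result; it is NOT the continuum limit and NOT the Clay problem.»  THIS MODULE is elementary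
[folklore] bookkeeping on `ℤ^D` over `ExpKernelCalculus` (`comp`, `tr`, `tadpole`, `l1_sub_triangle`, `Zl`) and `PackedKernelSplit.biBubble`:
reverse-triangle placement of the leg exponentials at the jets' anchors, Fubini for nonnegative series (`summable_of_sum_le`,
`Real.tsum_le_of_sum_le`, `Summable.tsum_finsetSum`, `tsum_of_norm_bounded`).  No `def`, no `def … : Prop`, nothing cited, nothing of the
manuscripts under audit asserted, 0 sorry.  NOT the instance at the road's leg `axDressK N K_m` ∕ stencils `coProj N (S m)` ∕ bi-tables `Wf m`
(α2-a PART 2 proper: block letters and N0b-S∕W masses DISPLAYED there), NOT the mass letters (M₁)(M₂) of the two-leg core (window sums of the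
displayed masses — instance arithmetic), NOT (LEDGER), NOT hsplit, NOT (ASYMP), NOT D1; 0∕4 row-D1 binders; NOT BetaPertH, NOT continuum, NOT Clay.

ABSOLUTE RULE (cell charter, verbatim): «No internally-minted statement may enter as a cited fact. Every hypothesis is either kernel-proved in this
package or a verbatim quotation of a PUBLISHED theorem with page reference. The manuscript(s) under audit are NOT citable for their own disputed
steps — they are the thing under adjudication; programme-internal (2001/route/tribunal) claims are never citable.»

WHY (R-FP-36 (b)): after α2-a PART 1 (`FineHessianBlockSplit`: `fineHessA = ff word + blockTerms` = 3 tadpole + 15 `biBubble` words at the shifted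
families) and α2-b PARTS 1–2 (`FineHessianLegSplit` ∕ `FineHessianGluonCore`: the R-words and defect words, again tadpoles and `biBubble`s), every
near piece `G_j` of the junction owes ONLY the pointwise majorant `|G_j c e b b′| ≤ M₁ b·M₂ b′·E₀·e^{−(2δ∕N)‖b′−b‖∞}` + two mass letters.  The tree's
word bounds (`ExpKernelCalculus.abs_bubble_le`, `PackedKernelSplitBounds.abs_biBubble_le`) force ONE rate on legs and jets, so at the leg rate `δ∕N`
their lattice constants `Zl(δ∕2N)` grow like `N^{2D}`; here each leg keeps its own sup constant and the common rate `r`, and each jet enters only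
through its r-weighted ℓ¹ mass at its anchor (an `O(1)`-localised block and a block-averaging window of radius `R·N` are served alike — sequel §1).

CONTENT ([folklore]).
* §1 tools: `exp_neg_l1_le_anchor` ∕ `exp_neg_l1_le_anchor'` (reverse-triangle placements), `mass_nonneg_of_letter`.
* §2 THE COLUMN MASS of a jet `K` anchored at `(p, p′)` under the finite-window letter
  `∀ T, Σ_{(y,z)∈T} Σ_{f,g} e^{r|y−p|₁}·e^{r|z−p′|₁}·|K y z f g| ≤ M`: section summability (`summable_colMass_section`), the anchored re-summation
  `sum_weight_colMass_le` ∕ `summable_weight_colMass` ∕ `tsum_weight_colMass_le` (`Σ′_z Σ_g e^{−r|z−q|₁}·m_K(z,g) ≤ e^{−r|p′−q|₁}·M`), and ONE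
  COMPOSITION **`abs_comp_le_colMass`** (`|comp A K x z a g| ≤ C_A·e^{−r|x−p|₁}·m_K(z,g)`).
* §3 THE WORDS: **`abs_tadpole_le_wmass`** (`|tadpole A W| ≤ C_A·Mw·e^{−r|q′−q|₁}`, `W` anchored `(q,q′)`), **`abs_biBubble_le_wmass`**
  (`|biBubble A V B W| ≤ C_A·C_B·Mv·Mw·(e^{−r|p′−q|₁}·e^{−r|q′−p|₁})`, `V` anchored `(p,p′)`, `W` anchored `(q,q′)`; all fibre sums inside the masses).
* SEQUEL `FP/WordPointwiseShapeHk.lean`: the closed-form masses (`BiLoc` jets: `(card F)²·C·Zl(δ−r)²`; windowed jets: `e^{rR}·e^{rR}·L`) and the (hk)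
  currency of `FineSplitJunctionTwoLeg` on `ℤ⁴` (`hk_biBubble`, `hk_tadpole`).
Provenance: D1 formalisation swarm LEAF PROVER 01, unit `b2b-balaban-beta-d1-formalise-leaf-01` gen 12, 2026-08-21, road FP row KER-γ (α2); «not in print; our bookkeeping».
-/

noncomputable section

namespace Summit.QuantumFields.BalabanUV.Beta.FP.WordPointwiseShape

open Finset
open scoped BigOperators
open Literature.MathematicalPhysics.QuantumFieldTheory.Balaban1983to89
open Literature.MathematicalPhysics.QuantumFieldTheory.Balaban1983to89.Beta
open B12Sec2to5 (l1 l1_nonneg)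
open ExpKernelCalculus (Site MKer Decays comp tr tadpole l1_sub_triangle l1_sub_symm)
open Summit.QuantumFields.BalabanUV.Beta.D1BFx.PackedKernelSplit (biBubble)

variable {D : ℕ} {F : Type*} [Fintype F]

/-! ## §1 Tools -/

omit [Fintype F] in
/-- [folklore] REVERSE-TRIANGLE PLACEMENT at an anchor `p` of the SECOND variable: `e^{−r|x−y|₁} ≤ e^{−r|x−p|₁}·e^{r|y−p|₁}` (`0 ≤ r`). -/
theorem exp_neg_l1_le_anchor {r : ℝ} (hr : 0 ≤ r) (x y p : Site D) :
    Real.exp (-r * l1 (x - y)) ≤ Real.exp (-r * l1 (x - p)) * Real.exp (r * l1 (y - p)) := by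
  rw [← Real.exp_add]
  apply Real.exp_le_exp.mpr
  have h := l1_sub_triangle x y p
  nlinarith

omit [Fintype F] in
/-- [folklore] REVERSE-TRIANGLE PLACEMENT at an anchor `p′` of the FIRST variable: `e^{−r|z−q|₁} ≤ e^{−r|p′−q|₁}·e^{r|z−p′|₁}` (`0 ≤ r`). -/
theorem exp_neg_l1_le_anchor' {r : ℝ} (hr : 0 ≤ r) (z q p' : Site D) :
    Real.exp (-r * l1 (z - q)) ≤ Real.exp (-r * l1 (p' - q)) * Real.exp (r * l1 (z - p')) := by
  rw [← Real.exp_add]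
  apply Real.exp_le_exp.mpr
  have h := l1_sub_triangle p' z q
  have e : l1 (p' - z) = l1 (z - p') := l1_sub_symm p' z
  rw [e] at h
  nlinarith

/-- [folklore] The finite-window mass letter makes the mass nonnegative (`T = ∅`). -/
theorem mass_nonneg_of_letter {K : MKer D F} {p p' : Site D} {r M : ℝ}
    (hM : ∀ T : Finset (Site D × Site D), ∑ yz ∈ T, ∑ f, ∑ g,
      Real.exp (r * l1 (yz.1 - p)) * Real.exp (r * l1 (yz.2 - p')) * |K yz.1 yz.2 f g| ≤ M) : 0 ≤ M := by
  simpa using hM ∅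

/-! ## §2 The column mass of an anchored jet and ONE composition -/

section ColMass

variable {K : MKer D F} {p p' : Site D} {r M : ℝ}

/-- [folklore] SECTION SUMMABILITY: under the finite-window mass letter at `(p, p′)`, for every column `(z, g)` the weighted column series
`y ↦ Σ_f e^{r|y−p|₁}·|K y z f g|` is summable (`0 ≤ r`). -/
theorem summable_colMass_section (hr : 0 ≤ r)
    (hM : ∀ T : Finset (Site D × Site D), ∑ yz ∈ T, ∑ f, ∑ g,
      Real.exp (r * l1 (yz.1 - p)) * Real.exp (r * l1 (yz.2 - p')) * |K yz.1 yz.2 f g| ≤ M) (z : Site D) (g : F) :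
    Summable fun y : Site D => ∑ f, Real.exp (r * l1 (y - p)) * |K y z f g| := by
  classical
  refine summable_of_sum_le (c := M) (fun y => Finset.sum_nonneg fun _ _ => by positivity) fun T => ?_
  have hz1 : (1 : ℝ) ≤ Real.exp (r * l1 (z - p')) := Real.one_le_exp (mul_nonneg hr (l1_nonneg _))
  calc ∑ y ∈ T, ∑ f, Real.exp (r * l1 (y - p)) * |K y z f g|
      ≤ ∑ y ∈ T, ∑ f, ∑ g', Real.exp (r * l1 (y - p)) * Real.exp (r * l1 (z - p')) * |K y z f g'| := by
        refine Finset.sum_le_sum fun y _ => Finset.sum_le_sum fun f _ => ?_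
        calc Real.exp (r * l1 (y - p)) * |K y z f g|
            ≤ Real.exp (r * l1 (y - p)) * Real.exp (r * l1 (z - p')) * |K y z f g| := by
              rw [mul_assoc]
              exact mul_le_mul_of_nonneg_left (le_mul_of_one_le_left (abs_nonneg _) hz1) (Real.exp_pos _).le
          _ ≤ ∑ g', Real.exp (r * l1 (y - p)) * Real.exp (r * l1 (z - p')) * |K y z f g'| :=
              Finset.single_le_sum (f := fun g' => Real.exp (r * l1 (y - p)) * Real.exp (r * l1 (z - p')) * |K y z f g'|)
                (fun _ _ => by positivity) (Finset.mem_univ g)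
    _ = ∑ yz ∈ T ×ˢ ({z} : Finset (Site D)), ∑ f, ∑ g',
          Real.exp (r * l1 (yz.1 - p)) * Real.exp (r * l1 (yz.2 - p')) * |K yz.1 yz.2 f g'| := by
        rw [Finset.sum_product]
        simp only [Finset.sum_singleton]
    _ ≤ M := hM _

/-- [folklore] the column mass is nonnegative. -/
theorem colMass_nonneg (K : MKer D F) (p : Site D) (r : ℝ) (z : Site D) (g : F) :
    0 ≤ ∑' y : Site D, ∑ f, Real.exp (r * l1 (y - p)) * |K y z f g| :=
  tsum_nonneg fun _ => Finset.sum_nonneg fun _ _ => by positivity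

/-- [folklore] **THE ANCHORED RE-SUMMATION OF THE COLUMN MASSES** (finite form): for every point `q` and finite `Tz`,
`Σ_{z∈Tz} Σ_g e^{−r|z−q|₁}·(Σ′_y Σ_f e^{r|y−p|₁}|K y z f g|) ≤ e^{−r|p′−q|₁}·M`. -/
theorem sum_weight_colMass_le (hr : 0 ≤ r)
    (hM : ∀ T : Finset (Site D × Site D), ∑ yz ∈ T, ∑ f, ∑ g,
      Real.exp (r * l1 (yz.1 - p)) * Real.exp (r * l1 (yz.2 - p')) * |K yz.1 yz.2 f g| ≤ M) (q : Site D) (Tz : Finset (Site D)) :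
    ∑ z ∈ Tz, ∑ g, Real.exp (-r * l1 (z - q)) * (∑' y : Site D, ∑ f, Real.exp (r * l1 (y - p)) * |K y z f g|)
      ≤ Real.exp (-r * l1 (p' - q)) * M := by
  classical
  have hsec := summable_colMass_section hr hM
  -- move the finite sums inside the `y`-series
  have hsum1 : ∀ z, ∑ g, Real.exp (-r * l1 (z - q)) * (∑' y : Site D, ∑ f, Real.exp (r * l1 (y - p)) * |K y z f g|)
      = ∑' y : Site D, ∑ g, Real.exp (-r * l1 (z - q)) * ∑ f, Real.exp (r * l1 (y - p)) * |K y z f g| := by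
    intro z
    rw [Summable.tsum_finsetSum (s := Finset.univ) fun g _ => (hsec z g).mul_left _]
    exact Finset.sum_congr rfl fun g _ => tsum_mul_left.symm
  have hsumg : ∀ z, Summable fun y : Site D => ∑ g, Real.exp (-r * l1 (z - q)) * ∑ f, Real.exp (r * l1 (y - p)) * |K y z f g| :=
    fun z => summable_sum fun g _ => (hsec z g).mul_left _
  rw [Finset.sum_congr rfl fun z _ => hsum1 z, ← Summable.tsum_finsetSum (s := Tz) fun z _ => hsumg z]
  refine Real.tsum_le_of_sum_le (fun y => Finset.sum_nonneg fun z _ => Finset.sum_nonneg fun g _ =>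
    mul_nonneg (Real.exp_pos _).le (Finset.sum_nonneg fun f _ => by positivity)) fun Ty => ?_
  -- pointwise: place the weight at the anchor `p′`
  have hpt : ∀ y z, ∑ g, Real.exp (-r * l1 (z - q)) * ∑ f, Real.exp (r * l1 (y - p)) * |K y z f g|
      ≤ Real.exp (-r * l1 (p' - q)) * ∑ f, ∑ g, Real.exp (r * l1 (y - p)) * Real.exp (r * l1 (z - p')) * |K y z f g| := by
    intro y z
    have h := exp_neg_l1_le_anchor' (D := D) hr z q p'
    simp_rw [Finset.mul_sum]
    rw [Finset.sum_comm]
    refine Finset.sum_le_sum fun f _ => Finset.sum_le_sum fun g _ => ?_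
    calc Real.exp (-r * l1 (z - q)) * (Real.exp (r * l1 (y - p)) * |K y z f g|)
        ≤ (Real.exp (-r * l1 (p' - q)) * Real.exp (r * l1 (z - p'))) * (Real.exp (r * l1 (y - p)) * |K y z f g|) :=
          mul_le_mul_of_nonneg_right h (by positivity)
      _ = _ := by ring
  calc ∑ y ∈ Ty, ∑ z ∈ Tz, ∑ g, Real.exp (-r * l1 (z - q)) * ∑ f, Real.exp (r * l1 (y - p)) * |K y z f g|
      ≤ ∑ y ∈ Ty, ∑ z ∈ Tz, Real.exp (-r * l1 (p' - q)) *
          ∑ f, ∑ g, Real.exp (r * l1 (y - p)) * Real.exp (r * l1 (z - p')) * |K y z f g| :=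
        Finset.sum_le_sum fun y _ => Finset.sum_le_sum fun z _ => hpt y z
    _ = Real.exp (-r * l1 (p' - q)) * ∑ yz ∈ Ty ×ˢ Tz, ∑ f, ∑ g,
          Real.exp (r * l1 (yz.1 - p)) * Real.exp (r * l1 (yz.2 - p')) * |K yz.1 yz.2 f g| := by
        rw [Finset.sum_product, Finset.mul_sum]
        exact Finset.sum_congr rfl fun y _ => (Finset.mul_sum _ _ _).symm
    _ ≤ Real.exp (-r * l1 (p' - q)) * M := mul_le_mul_of_nonneg_left (hM _) (Real.exp_pos _).le

/-- [folklore] the anchored weighted column-mass series is summable. -/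
theorem summable_weight_colMass (hr : 0 ≤ r)
    (hM : ∀ T : Finset (Site D × Site D), ∑ yz ∈ T, ∑ f, ∑ g,
      Real.exp (r * l1 (yz.1 - p)) * Real.exp (r * l1 (yz.2 - p')) * |K yz.1 yz.2 f g| ≤ M) (q : Site D) :
    Summable fun z : Site D => ∑ g, Real.exp (-r * l1 (z - q)) * (∑' y : Site D, ∑ f, Real.exp (r * l1 (y - p)) * |K y z f g|) :=
  summable_of_sum_le (fun z => Finset.sum_nonneg fun g _ => mul_nonneg (Real.exp_pos _).le (colMass_nonneg K p r z g))
    (sum_weight_colMass_le hr hM q)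

/-- [folklore] **THE ANCHORED RE-SUMMATION OF THE COLUMN MASSES**: `Σ′_z Σ_g e^{−r|z−q|₁}·m_K(z,g) ≤ e^{−r|p′−q|₁}·M`. -/
theorem tsum_weight_colMass_le (hr : 0 ≤ r)
    (hM : ∀ T : Finset (Site D × Site D), ∑ yz ∈ T, ∑ f, ∑ g,
      Real.exp (r * l1 (yz.1 - p)) * Real.exp (r * l1 (yz.2 - p')) * |K yz.1 yz.2 f g| ≤ M) (q : Site D) :
    ∑' z : Site D, ∑ g, Real.exp (-r * l1 (z - q)) * (∑' y : Site D, ∑ f, Real.exp (r * l1 (y - p)) * |K y z f g|)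
      ≤ Real.exp (-r * l1 (p' - q)) * M :=
  Real.tsum_le_of_sum_le (fun z => Finset.sum_nonneg fun g _ => mul_nonneg (Real.exp_pos _).le (colMass_nonneg K p r z g))
    (sum_weight_colMass_le hr hM q)

/-- [folklore] **ONE COMPOSITION**: a leg with the letter `|A x y a b| ≤ C_A·e^{−r|x−y|₁}` (`Decays A C_A r`, `0 ≤ r`) against a jet `K` anchored at
`(p, p′)` with the finite-window mass letter ⟹ `|comp A K x z a g| ≤ C_A·e^{−r|x−p|₁}·m_K(z,g)`, `m_K(z,g) := Σ′_y Σ_f e^{r|y−p|₁}·|K y z f g|`. -/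
theorem abs_comp_le_colMass {A : MKer D F} {C_A : ℝ} (hA : Decays A C_A r) (hr : 0 ≤ r)
    (hM : ∀ T : Finset (Site D × Site D), ∑ yz ∈ T, ∑ f, ∑ g,
      Real.exp (r * l1 (yz.1 - p)) * Real.exp (r * l1 (yz.2 - p')) * |K yz.1 yz.2 f g| ≤ M) (x z : Site D) (a g : F) :
    |comp A K x z a g| ≤ C_A * Real.exp (-r * l1 (x - p)) * (∑' y : Site D, ∑ f, Real.exp (r * l1 (y - p)) * |K y z f g|) := by
  have hCA : 0 ≤ C_A := hA.nonneg a
  unfold ExpKernelCalculus.comp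
  have hmaj := ((summable_colMass_section hr hM z g).mul_left (C_A * Real.exp (-r * l1 (x - p)))).hasSum
  have hb := tsum_of_norm_bounded hmaj (f := fun y => ∑ f, A x y a f * K y z f g) fun y => by
    rw [Real.norm_eq_abs, Finset.mul_sum]
    refine (Finset.abs_sum_le_sum_abs _ _).trans (Finset.sum_le_sum fun f _ => ?_)
    rw [abs_mul]
    calc |A x y a f| * |K y z f g| ≤ (C_A * Real.exp (-r * l1 (x - y))) * |K y z f g| :=
          mul_le_mul_of_nonneg_right (hA x y a f) (abs_nonneg _)
      _ ≤ (C_A * (Real.exp (-r * l1 (x - p)) * Real.exp (r * l1 (y - p)))) * |K y z f g| :=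
          mul_le_mul_of_nonneg_right (mul_le_mul_of_nonneg_left (exp_neg_l1_le_anchor (D := D) hr x y p) hCA) (abs_nonneg _)
      _ = _ := by ring
  rw [Real.norm_eq_abs] at hb
  refine hb.trans (le_of_eq ?_)
  rw [tsum_mul_left]

end ColMass

/-! ## §3 The words -/

section Words

variable {A B V W : MKer D F} {C_A C_B r Mv Mw : ℝ} {p p' q q' : Site D}

/-- **THE POINTWISE SHAPE OF A TADPOLE WORD** [folklore]: a leg `|A x y a b| ≤ C_A·e^{−r|x−y|₁}` (`0 ≤ r`) and a (bi-)table `W` anchored at `(q, q′)` with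
r-weighted mass letter `∀ T, Σ_{(y,z)∈T} Σ_{f,g} e^{r|y−q|₁}·e^{r|z−q′|₁}·|W y z f g| ≤ Mw` ⟹ `|tadpole A W| ≤ C_A·Mw·e^{−r|q′−q|₁}` — ONE leg between the two
anchors, every fibre sum inside the mass. -/
theorem abs_tadpole_le_wmass [Nonempty F] (hA : Decays A C_A r) (hr : 0 ≤ r)
    (hW : ∀ T : Finset (Site D × Site D), ∑ yz ∈ T, ∑ f, ∑ g,
      Real.exp (r * l1 (yz.1 - q)) * Real.exp (r * l1 (yz.2 - q')) * |W yz.1 yz.2 f g| ≤ Mw) :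
    |tadpole A W| ≤ C_A * Mw * Real.exp (-r * l1 (q' - q)) := by
  obtain ⟨a₀⟩ := ‹Nonempty F›
  have hCA : 0 ≤ C_A := hA.nonneg a₀
  unfold ExpKernelCalculus.tadpole ExpKernelCalculus.tr
  have hmaj := ((summable_weight_colMass hr hW q).mul_left C_A).hasSum
  have hb := tsum_of_norm_bounded hmaj (f := fun x => ∑ a, comp A W x x a a) fun x => by
    rw [Real.norm_eq_abs, Finset.mul_sum]
    refine (Finset.abs_sum_le_sum_abs _ _).trans (Finset.sum_le_sum fun a _ => ?_)
    calc |comp A W x x a a|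
        ≤ C_A * Real.exp (-r * l1 (x - q)) * (∑' y : Site D, ∑ f, Real.exp (r * l1 (y - q)) * |W y x f a|) :=
          abs_comp_le_colMass hA hr hW x x a a
      _ = _ := by ring
  rw [Real.norm_eq_abs] at hb
  refine hb.trans ?_
  rw [tsum_mul_left]
  calc C_A * ∑' z : Site D, ∑ g, Real.exp (-r * l1 (z - q)) * (∑' y : Site D, ∑ f, Real.exp (r * l1 (y - q)) * |W y z f g|)
      ≤ C_A * (Real.exp (-r * l1 (q' - q)) * Mw) := mul_le_mul_of_nonneg_left (tsum_weight_colMass_le hr hW q) hCA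
    _ = _ := by ring

/-- **THE POINTWISE SHAPE OF A TWO-LEG BUBBLE WORD** [folklore]: legs `|A x y a b| ≤ C_A·e^{−r|x−y|₁}`, `|B x y a b| ≤ C_B·e^{−r|x−y|₁}` (`0 ≤ r`), a jet `V`
anchored at `(p, p′)` with r-weighted mass letter `Mv` and a jet `W` anchored at `(q, q′)` with `Mw` ⟹
`|biBubble A V B W| ≤ C_A·C_B·Mv·Mw·(e^{−r|p′−q|₁}·e^{−r|q′−p|₁})` — the leg `B` runs from `V`'s second anchor to `W`'s first, the leg `A` from `W`'s
second anchor back to `V`'s first; all four fibre sums sit inside the two masses (no `card F`). -/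
theorem abs_biBubble_le_wmass [Nonempty F] (hA : Decays A C_A r) (hB : Decays B C_B r) (hr : 0 ≤ r)
    (hV : ∀ T : Finset (Site D × Site D), ∑ yz ∈ T, ∑ f, ∑ g,
      Real.exp (r * l1 (yz.1 - p)) * Real.exp (r * l1 (yz.2 - p')) * |V yz.1 yz.2 f g| ≤ Mv)
    (hW : ∀ T : Finset (Site D × Site D), ∑ yz ∈ T, ∑ f, ∑ g,
      Real.exp (r * l1 (yz.1 - q)) * Real.exp (r * l1 (yz.2 - q')) * |W yz.1 yz.2 f g| ≤ Mw) :
    |biBubble A V B W| ≤ C_A * C_B * Mv * Mw * (Real.exp (-r * l1 (p' - q)) * Real.exp (-r * l1 (q' - p))) := by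
  obtain ⟨a₀⟩ := ‹Nonempty F›
  have hCA : 0 ≤ C_A := hA.nonneg a₀
  have hCB : 0 ≤ C_B := hB.nonneg a₀
  have hMv : 0 ≤ Mv := mass_nonneg_of_letter hV
  have hMw : 0 ≤ Mw := mass_nonneg_of_letter hW
  -- the two anchored re-summations
  set ΘV : ℝ := ∑' z : Site D, ∑ g, Real.exp (-r * l1 (z - q)) * (∑' y : Site D, ∑ f, Real.exp (r * l1 (y - p)) * |V y z f g|)
    with hΘV
  set ΘW : ℝ := ∑' x : Site D, ∑ a, Real.exp (-r * l1 (x - p)) * (∑' y : Site D, ∑ f, Real.exp (r * l1 (y - q)) * |W y x f a|)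
    with hΘW
  have hΘV_le : ΘV ≤ Real.exp (-r * l1 (p' - q)) * Mv := tsum_weight_colMass_le hr hV q
  have hΘW_le : ΘW ≤ Real.exp (-r * l1 (q' - p)) * Mw := tsum_weight_colMass_le hr hW p
  have hΘV0 : 0 ≤ ΘV :=
    tsum_nonneg fun z => Finset.sum_nonneg fun g _ => mul_nonneg (Real.exp_pos _).le (colMass_nonneg V p r z g)
  -- the inner series at fixed `(x, a)`
  have hinner : ∀ (x : Site D) (a : F), |comp (comp A V) (comp B W) x x a a|
      ≤ C_A * C_B * ΘV * (Real.exp (-r * l1 (x - p)) * ∑' y : Site D, ∑ f, Real.exp (r * l1 (y - q)) * |W y x f a|) := by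
    intro x a
    rw [show comp (comp A V) (comp B W) x x a a = ∑' z : Site D, ∑ g, comp A V x z a g * comp B W z x g a from rfl]
    have hmW : 0 ≤ ∑' y : Site D, ∑ f, Real.exp (r * l1 (y - q)) * |W y x f a| := colMass_nonneg W q r x a
    have hmaj := ((summable_weight_colMass hr hV q).mul_left
      (C_A * C_B * Real.exp (-r * l1 (x - p)) * ∑' y : Site D, ∑ f, Real.exp (r * l1 (y - q)) * |W y x f a|)).hasSum
    have hb := tsum_of_norm_bounded hmaj (f := fun z => ∑ g, comp A V x z a g * comp B W z x g a) fun z => by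
      rw [Real.norm_eq_abs, Finset.mul_sum]
      refine (Finset.abs_sum_le_sum_abs _ _).trans (Finset.sum_le_sum fun g _ => ?_)
      rw [abs_mul]
      have h1 := abs_comp_le_colMass hA hr hV x z a g
      have h2 := abs_comp_le_colMass hB hr hW z x g a
      calc |comp A V x z a g| * |comp B W z x g a|
          ≤ (C_A * Real.exp (-r * l1 (x - p)) * ∑' y : Site D, ∑ f, Real.exp (r * l1 (y - p)) * |V y z f g|) *
              (C_B * Real.exp (-r * l1 (z - q)) * ∑' y : Site D, ∑ f, Real.exp (r * l1 (y - q)) * |W y x f a|) :=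
            mul_le_mul h1 h2 (abs_nonneg _)
              (mul_nonneg (mul_nonneg hCA (Real.exp_pos _).le) (colMass_nonneg V p r z g))
        _ = _ := by ring
    rw [Real.norm_eq_abs] at hb
    refine hb.trans (le_of_eq ?_)
    rw [tsum_mul_left]
    ring
  -- the outer series
  unfold biBubble ExpKernelCalculus.tr
  have hmaj := ((summable_weight_colMass hr hW p).mul_left (C_A * C_B * ΘV)).hasSum
  have hb := tsum_of_norm_bounded hmaj (f := fun x => ∑ a, comp (comp A V) (comp B W) x x a a) fun x => by
    rw [Real.norm_eq_abs, Finset.mul_sum]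
    exact (Finset.abs_sum_le_sum_abs _ _).trans (Finset.sum_le_sum fun a _ => hinner x a)
  rw [Real.norm_eq_abs] at hb
  refine hb.trans ?_
  rw [tsum_mul_left]
  calc C_A * C_B * ΘV * ΘW
      ≤ C_A * C_B * (Real.exp (-r * l1 (p' - q)) * Mv) * (Real.exp (-r * l1 (q' - p)) * Mw) :=
        mul_le_mul (mul_le_mul_of_nonneg_left hΘV_le (mul_nonneg hCA hCB)) hΘW_le
          (le_trans hΘV0 hΘV_le |> fun _ => by
            exact tsum_nonneg fun x => Finset.sum_nonneg fun a _ => mul_nonneg (Real.exp_pos _).le (colMass_nonneg W q r x a))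
          (mul_nonneg (mul_nonneg hCA hCB) (mul_nonneg (Real.exp_pos _).le hMv))
    _ = _ := by ring

end Words

end Summit.QuantumFields.BalabanUV.Beta.FP.WordPointwiseShape

end
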